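import Mathlib
import Literature.Probability.Percolation.MinOpenCut
import Literature.Probability.Percolation.PercolationEvents
import Literature.Probability.Percolation.BondPercolationEfronStein
import Summits.CriticalPhenomena.PercolationContinuityZ3.Theorems.DefectDimension.Negative.AllOpenCutsets
import HarnessLib

/-!
# Crux `PercBudgetLadder.DefectDimension` (stmt-CriticalPhenomena-5250), line `chemical-tortuosity-packing` — stub `stub_bootstrap`

Helper file for the crux skeleton `Cruxes/DefectDimension/Lines/chemical-tortuosity-packing.lean`
(lead prover-line-stmt-CriticalPhenomena-5250-0); proves exactly the registered stub `stub_bootstrap`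
(`--supports stmt-CriticalPhenomena-5250`). With `MinCut(n,2n)(ω) = minOpenCutIn B(2n) B(n) ∂ⁱⁿB(2n) ω`
and `budgetEvent n b = {MinCut(n,2n) ≤ b}` (the crux's event): if `P_{p_c}(budgetEvent n (n^{2-c})) ≥ δ`
at every large scale for some `c, δ > 0`, then `P_{p_c}(budgetEvent n (n^{2-c'})) → 1`, `c' = min(c,1/4)/2`.

ONE-SCALE second-moment argument (probability only; the percolation input is locality). For `n ≥ 1`
let `F = edgesIn (zdGraph 3) (box 3 (2n))` (`#F ≤ 6(4n+1)³ ≤ 750 n³`) and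
`f ω = MinCut(n,2n)(ω ∩ F).toNat ∈ ℝ` (`exists_observable`): measurable, bounded, determined by `F`,
1-Lipschitz under opening one edge, and a.s. (`ω ⊆ E(ℤ³)`) `budgetEvent n b = {f ≤ b}` by locality.
(1) Efron–Stein with bounded differences (`bondPercolation_variance_le_of_bounded_differences`, PROVED
in the tree): `Var f ≤ p(1-p)#F ≤ 750 n³`. (2) Chebyshev (`meas_ge_le_variance_div_sq`,
`integral_le_of_variance_lt`) with `t = n^{7/4}`: eventually `750 n³ < δ t²`, so `{f ≤ n^{2-c}}`
(probability `≥ δ`) meets `{|f - E f| < t}` and `E f ≤ n^{2-c} + n^{7/4} ≤ 2 n^{2-2c'}`. (3) Markov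
(`mul_meas_ge_le_integral_of_nonneg`, `one_sub_integral_div_le`):
`P(budgetEvent n (n^{2-c'})) ≥ 1 - E f / n^{2-c'} ≥ 1 - 2 n^{-c'} → 1`.
The `StubBootstrap` lemmas on `MinCut(n,2n)` (finiteness, Lipschitz, locality, measurability, `#F`)
are adapted from the non-importable sibling skeletons `Cruxes/DefectDimension/Lines/
talagrand-window-amplifier.lean` and `…/anchored-density-contraction.lean`. No new definitions:
`MinCut⟦n⟧` and `F⟦n⟧` below are file-local notations for tree terms.
-/

noncomputable section
namespace Summit.CriticalPhenomena.PercolationContinuityZ3.Theorems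
open MeasureTheory ProbabilityTheory Filter Topology
open Literature.Probability.Percolation Literature.Probability.LatticeModels
open Summit.CriticalPhenomena.PercolationContinuityZ3.Theorems.DefectDimension.Negative (budgetEvent mem_budgetEvent_iff mem_budgetEvent_nat_iff notMem_box_of_mem_innerBoundary)

/-- `MinCut⟦n⟧ ω = MinCut(n,2n)(ω) ∈ ℕ∞`, the min-cut budget of the annulus `A(n,2n)` inside `B(2n)`
(file-local notation for the tree term `minOpenCutIn ↑(box 3 (2n)) ↑(box 3 n) ↑(∂ⁱⁿ box 3 (2n))`). -/
local notation:max "MinCut⟦" n "⟧" => minOpenCutIn ((box 3 (2 * n) : Finset (Site 3)) : Set (Site 3))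
  ((box 3 n : Finset (Site 3)) : Set (Site 3))
  ((innerBoundary (zdGraph 3) (box 3 (2 * n)) : Finset (Site 3)) : Set (Site 3))
/-- `F⟦n⟧ = edgesIn (zdGraph 3) (box 3 (2n))`, the lattice edges of `B(2n)` (file-local notation). -/
local notation:max "F⟦" n "⟧" => edgesIn (zdGraph 3) (box 3 (2 * n))

namespace StubBootstrap

-- adapted from Cruxes/DefectDimension/Lines/talagrand-window-amplifier.lean (`annMinCut_le_card_sym2`)
/-- Closing every pair inside `B(2n)` blocks the annulus (`n ≥ 1`): `MinCut(n,2n) ≤ #pairs(B(2n))`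
for EVERY configuration. -/
theorem minCut_le_card_sym2 {n : ℕ} (hn : 1 ≤ n) (ω : BondConfig (Site 3)) :
    MinCut⟦n⟧ ω ≤ (((box 3 (2 * n)).sym2.card : ℕ) : ℕ∞) := by
  apply minOpenCutIn_le_card
  intro x hx y hy hconn
  obtain ⟨hxS, hyS, hr⟩ := hconn
  have hle : (openGraph (ω \ ↑((box 3 (2 * n)).sym2))).induce (↑(box 3 (2 * n)) : Set (Site 3)) ≤ ⊥ := by
    intro a b hab
    rw [SimpleGraph.induce_adj, openGraph_adj] at hab
    obtain ⟨⟨-, hnot⟩, -⟩ := hab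
    apply hnot
    rw [Finset.coe_sym2]
    exact Set.mk_mem_sym2_iff.2 ⟨a.2, b.2⟩
  have hxy := hr.mono hle
  rw [SimpleGraph.reachable_bot] at hxy
  have hxy' : x = y := congrArg Subtype.val hxy
  exact notMem_box_of_mem_innerBoundary hn hy (hxy' ▸ hx)

/-- Hence `MinCut(n,2n)(ω) < ⊤` for every configuration (`n ≥ 1`). -/
theorem minCut_ne_top {n : ℕ} (hn : 1 ≤ n) (ω : BondConfig (Site 3)) : MinCut⟦n⟧ ω ≠ ⊤ :=
  ne_top_of_le_ne_top (ENat.coe_ne_top _) (minCut_le_card_sym2 hn ω)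

-- adapted from Cruxes/DefectDimension/Lines/talagrand-window-amplifier.lean (`annMinCut_insert_le`)
/-- **1-Lipschitz under opening an edge**: `MinCut(ω ∪ {e}) ≤ MinCut(ω) + 1` (an optimal cutset `T`
of `ω` gives the cutset `T ∪ {e}` of `ω ∪ {e}`). -/
theorem minCut_insert_le (n : ℕ) (ω : BondConfig (Site 3)) (e : Sym2 (Site 3)) :
    MinCut⟦n⟧ (insert e ω) ≤ MinCut⟦n⟧ ω + 1 := by
  classical
  by_cases htop : MinCut⟦n⟧ ω = ⊤
  · rw [htop, top_add]; exact le_top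
  obtain ⟨T, hT, hcard⟩ := exists_eq_minOpenCutIn htop
  have hset : insert e ω \ (↑(insert e T) : Set (Sym2 (Site 3))) = ω \ ↑(insert e T) := by
    ext x
    simp only [Set.mem_sdiff, Set.mem_insert_iff, Finset.coe_insert]
    tauto
  have hT' := hT.mono (Finset.coe_subset.2 (Finset.subset_insert e T))
  have hcut : IsOpenCutsetIn (↑(box 3 (2 * n)) : Set (Site 3)) ↑(box 3 n)
      ↑(innerBoundary (zdGraph 3) (box 3 (2 * n))) (insert e ω) ↑(insert e T) := by
    intro x hx y hy
    rw [hset]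
    exact hT' x hx y hy
  calc MinCut⟦n⟧ (insert e ω) ≤ ((insert e T).card : ℕ∞) := minOpenCutIn_le_card hcut
    _ ≤ ((T.card + 1 : ℕ) : ℕ∞) := by exact_mod_cast Finset.card_insert_le e T
    _ = MinCut⟦n⟧ ω + 1 := by push_cast; rw [hcard]

/-- The lattice edges of the box are edges of `ℤ³`. -/
theorem coe_F_subset_edgeSet (n : ℕ) : (↑(F⟦n⟧) : Set (Sym2 (Site 3))) ⊆ (zdGraph 3).edgeSet :=
  fun _ he => (mem_edgesIn_iff.1 (Finset.mem_coe.1 he)).1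

/-- For a lattice configuration `ω ⊆ E(ℤ³)`, its edges in `F` are exactly its pairs inside `B(2n)`. -/
theorem inter_F_eq {n : ℕ} {ω : BondConfig (Site 3)} (hω : ω ⊆ (zdGraph 3).edgeSet) :
    ω ∩ ↑(F⟦n⟧) = ω ∩ (↑(box 3 (2 * n)) : Set (Site 3)).sym2 := by
  ext e
  simp only [Set.mem_inter_iff, Finset.mem_coe, mem_edgesIn_iff, and_congr_right_iff]
  intro heω
  induction e using Sym2.ind with
  | h a b =>
    rw [Set.mk_mem_sym2_iff]
    constructor
    · rintro ⟨-, h⟩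
      exact ⟨h a (Sym2.mem_mk_left a b), h b (Sym2.mem_mk_right a b)⟩
    · rintro ⟨ha, hb⟩
      refine ⟨hω heω, fun x hx => ?_⟩
      rcases Sym2.mem_iff.1 hx with rfl | rfl
      · exact ha
      · exact hb

-- adapted from Cruxes/DefectDimension/Lines/talagrand-window-amplifier.lean (`annMinCut_inter_sym2`)
/-- **Locality** (`determinedBy_setOf_minOpenCutIn_le`): for a lattice configuration, the budget
events read through `F` are the budget events, `MinCut(ω ∩ F) ≤ k ↔ MinCut(ω) ≤ k`. -/
theorem minCut_inter_le_iff {n : ℕ} {ω : BondConfig (Site 3)} (hω : ω ⊆ (zdGraph 3).edgeSet)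
    (k : ℕ) : MinCut⟦n⟧ (ω ∩ ↑(F⟦n⟧)) ≤ k ↔ MinCut⟦n⟧ ω ≤ k := by
  rw [inter_F_eq hω]
  exact (determinedBy_iff _ _).1 (determinedBy_setOf_minOpenCutIn_le _ _ _ k)
    _ ω (by rw [Set.inter_assoc, Set.inter_self])

-- adapted from Cruxes/DefectDimension/Lines/talagrand-window-amplifier.lean (`card_edgesIn_box_le`)
/-- `#F ≤ 6 (4n+1)³ ≤ 750 n³` for `n ≥ 1` (each of the `(4n+1)³ ≤ (5n)³` sites of `B(2n)` has `6`
incident edges). -/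
theorem card_F_le {n : ℕ} (hn : 1 ≤ n) : ((F⟦n⟧).card : ℝ) ≤ 750 * (n : ℝ) ^ 3 := by
  classical
  have h0 : (F⟦n⟧).card ≤ 6 * (4 * n + 1) ^ 3 :=
    calc (edgesIn (zdGraph 3) (box 3 (2 * n))).card
        ≤ (edgesTouching (zdGraph 3) (box 3 (2 * n))).card :=
          Finset.card_le_card (edgesIn_subset_edgesTouching _)
      _ ≤ ∑ x ∈ box 3 (2 * n), ((zdGraph 3).incidenceFinset x).card := by
          unfold edgesTouching
          exact Finset.card_biUnion_le
      _ = ∑ x ∈ box 3 (2 * n), 6 := Finset.sum_congr rfl (fun x _ => by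
          rw [SimpleGraph.card_incidenceFinset_eq_degree, ← SimpleGraph.card_neighborFinset_eq_degree,
            card_neighborFinset_zdGraph_holds x])
      _ = 6 * (4 * n + 1) ^ 3 := by rw [Finset.sum_const, card_box, smul_eq_mul]; ring
  have h1 : (((F⟦n⟧).card : ℕ) : ℝ) ≤ ((6 * (4 * n + 1) ^ 3 : ℕ) : ℝ) := by exact_mod_cast h0
  push_cast at h1
  have hnR : (1 : ℝ) ≤ n := by exact_mod_cast hn
  have h2 : (4 * (n : ℝ) + 1) ^ 3 ≤ (5 * (n : ℝ)) ^ 3 :=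
    pow_le_pow_left₀ (by positivity) (by linarith) 3
  nlinarith [h1, h2]

-- adapted from Cruxes/DefectDimension/Lines/anchored-density-contraction.lean (`measurable_annCut`)
/-- `ω ↦ MinCut(n,2n)(ω)` is measurable (its level sets are cylinder events of the finite box). -/
theorem measurable_minCut (n : ℕ) : Measurable (MinCut⟦n⟧) := by
  rw [ENat.measurable_iff]
  intro k
  have hmeas : ∀ m : ℕ, MeasurableSet {ω : BondConfig (Site 3) | MinCut⟦n⟧ ω ≤ m} := fun m =>
    measurableSet_setOf_minOpenCutIn_le (Finset.finite_toSet _) _ _ m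
  have hset : MinCut⟦n⟧ ⁻¹' {(k : ℕ∞)} =
      {ω | MinCut⟦n⟧ ω ≤ k} \ ⋃ j ∈ Finset.range k, {ω | MinCut⟦n⟧ ω ≤ j} := by
    ext ω
    simp only [Set.mem_preimage, Set.mem_singleton_iff, Set.mem_sdiff, Set.mem_setOf_eq,
      Set.mem_iUnion, Finset.mem_range, exists_prop, not_exists, not_and]
    constructor
    · intro h
      refine ⟨h.le, fun j hj hle => ?_⟩
      rw [h] at hle
      exact absurd (ENat.coe_le_coe.1 hle) (not_le.2 hj)
    · rintro ⟨hle, hnot⟩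
      obtain ⟨m, hm⟩ := ENat.ne_top_iff_exists.1 (ne_top_of_le_ne_top (ENat.coe_ne_top k) hle)
      rw [← hm] at hle hnot ⊢
      rcases (ENat.coe_le_coe.1 hle).lt_or_eq with hlt | heq
      · exact absurd le_rfl (hnot m hlt)
      · rw [heq]
  rw [hset]
  exact (hmeas k).diff (Finset.measurableSet_biUnion _ fun j _ => hmeas j)

/-- For `b ≥ 0`: `ω ∈ budgetEvent n b ↔ MinCut(n,2n)(ω) ≤ ⌊b⌋₊` (`minOpenCutIn_le_iff`, the
cardinalities being natural numbers). -/
theorem mem_budgetEvent_iff_minCut_le {n : ℕ} {b : ℝ} (hb : 0 ≤ b) (ω : BondConfig (Site 3)) :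
    ω ∈ budgetEvent n b ↔ MinCut⟦n⟧ ω ≤ ⌊b⌋₊ := by
  rw [budgetEvent, Set.mem_setOf_eq, minOpenCutIn_le_iff]
  constructor
  · rintro ⟨S, hS, hcut⟩
    exact ⟨S, (Nat.le_floor_iff hb).2 hS, hcut⟩
  · rintro ⟨S, hS, hcut⟩
    exact ⟨S, (Nat.le_floor_iff hb).1 hS, hcut⟩

/-- **The observable.** For `n ≥ 1` and every `p` there is a measurable, nonnegative, square-integrable
`f : BondConfig → ℝ` (namely `f ω = MinCut(n,2n)(ω ∩ F).toNat`) with `Var_p f ≤ 750 n³`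
(Efron–Stein with bounded differences: `f` is determined by `F` and 1-Lipschitz) whose level sets are
the budget events up to `P_p`-null sets: `budgetEvent n b =ᵐ {f ≤ b}` for `b ≥ 0` (a.s. `ω ⊆ E(ℤ³)`,
`setBernoulli_ae_subset`, and locality). -/
theorem exists_observable {n : ℕ} (hn : 1 ≤ n) (p : unitInterval) :
    ∃ f : BondConfig (Site 3) → ℝ, Measurable f ∧ (∀ ω, 0 ≤ f ω) ∧
      MemLp f 2 (bondPercolation (zdGraph 3) p) ∧
      variance f (bondPercolation (zdGraph 3) p) ≤ 750 * (n : ℝ) ^ 3 ∧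
      ∀ b : ℝ, 0 ≤ b → (budgetEvent n b : Set (BondConfig (Site 3)))
        =ᵐ[bondPercolation (zdGraph 3) p] {ω | f ω ≤ b} := by
  set P : Measure (BondConfig (Site 3)) := bondPercolation (zdGraph 3) p with hP
  set f : BondConfig (Site 3) → ℝ := fun ω => (((MinCut⟦n⟧ (ω ∩ ↑(F⟦n⟧))).toNat : ℕ) : ℝ) with hf
  -- finiteness: `MinCut = ↑m`
  have hfin : ∀ ω : BondConfig (Site 3), ∃ m : ℕ, (m : ℕ∞) = MinCut⟦n⟧ ω := fun ω =>
    ENat.ne_top_iff_exists.1 (minCut_ne_top hn ω)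
  -- measurability
  have hinter : Measurable fun ω : BondConfig (Site 3) => ω ∩ (↑(F⟦n⟧) : Set (Sym2 (Site 3))) := by
    refine measurable_set_iff.2 fun e => ?_
    simp only [Set.mem_inter_iff]
    exact (measurable_set_mem e).and measurable_const
  have hfm : Measurable f :=
    (Measurable.of_discrete (f := fun m : ℕ∞ => (m.toNat : ℝ))).comp
      ((measurable_minCut n).comp hinter)
  -- bounds and square-integrability
  have hf0 : ∀ ω, 0 ≤ f ω := fun ω => Nat.cast_nonneg _
  have hfle : ∀ ω, f ω ≤ (((box 3 (2 * n)).sym2.card : ℕ) : ℝ) := fun ω => by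
    simp only [hf]
    exact_mod_cast ENat.toNat_le_of_le_coe (minCut_le_card_sym2 hn _)
  have hf2 : MemLp f 2 P := memLp_of_bounded (ae_of_all _ fun ω => ⟨hf0 ω, hfle ω⟩)
    hfm.aestronglyMeasurable 2
  -- determined by `F`, bounded differences `1`
  have hdet : ∀ ω, f ω = f (ω ∩ ↑(F⟦n⟧)) := fun ω => by
    simp only [hf, Set.inter_assoc, Set.inter_self]
  have hlip : ∀ ω : BondConfig (Site 3), ∀ e ∈ F⟦n⟧, e ∉ ω →
      |f (insert e ω) - f ω| ≤ (fun _ => (1 : ℝ)) e := by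
    intro ω e he _
    have hins : insert e ω ∩ (↑(F⟦n⟧) : Set (Sym2 (Site 3))) = insert e (ω ∩ ↑(F⟦n⟧)) :=
      Set.insert_inter_of_mem (Finset.mem_coe.2 he)
    have h1 : MinCut⟦n⟧ (ω ∩ ↑(F⟦n⟧)) ≤ MinCut⟦n⟧ (insert e (ω ∩ ↑(F⟦n⟧))) :=
      minOpenCutIn_mono_config (Set.subset_insert e _)
    have h2 := minCut_insert_le n (ω ∩ ↑(F⟦n⟧)) e
    obtain ⟨m, hm⟩ := hfin (ω ∩ ↑(F⟦n⟧))
    obtain ⟨m', hm'⟩ := hfin (insert e (ω ∩ ↑(F⟦n⟧)))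
    simp only [hf, hins]
    rw [← hm, ← hm'] at h1 h2 ⊢
    rw [ENat.toNat_coe, ENat.toNat_coe]
    have h1R : (m : ℝ) ≤ m' := by exact_mod_cast (by exact_mod_cast h1 : m ≤ m')
    have h2R : (m' : ℝ) ≤ m + 1 := by exact_mod_cast (by exact_mod_cast h2 : m' ≤ m + 1)
    rw [abs_le]
    constructor <;> linarith
  refine ⟨f, hfm, hf0, hf2, ?_, ?_⟩
  · -- Efron–Stein with bounded differences, `p(1-p) ≤ 1`, `#F ≤ 750 n³`
    have hV := bondPercolation_variance_le_of_bounded_differences (zdGraph 3) p (F⟦n⟧)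
      (coe_F_subset_edgeSet n) hfm hf2 hdet (fun _ => 1) hlip
    have hp0 : (0 : ℝ) ≤ p := p.2.1
    have hp1 : (p : ℝ) ≤ 1 := p.2.2
    have hsum : ∑ e ∈ F⟦n⟧, ((fun _ => (1 : ℝ)) e) ^ 2 = ((F⟦n⟧).card : ℝ) := by simp
    rw [hsum] at hV
    have h2 : (p : ℝ) * (1 - p) * ((F⟦n⟧).card : ℝ) ≤ 1 * ((F⟦n⟧).card : ℝ) :=
      mul_le_mul_of_nonneg_right (by nlinarith) (Nat.cast_nonneg _)
    linarith [card_F_le hn]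
  · -- a.s. `ω ⊆ E(ℤ³)`, where the level sets agree by locality
    intro b hb
    have hae : ∀ᵐ ω ∂P, ω ⊆ (zdGraph 3).edgeSet := by
      rw [hP, bondPercolation]; exact setBernoulli_ae_subset
    filter_upwards [hae] with ω hω
    show (ω ∈ budgetEvent n b) = (ω ∈ {ω | f ω ≤ b})
    rw [Set.mem_setOf_eq]
    refine propext ((mem_budgetEvent_iff_minCut_le hb ω).trans
      ((minCut_inter_le_iff hω _).symm.trans ?_))
    obtain ⟨m, hm⟩ := hfin (ω ∩ ↑(F⟦n⟧))
    simp only [hf]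
    rw [← hm, ENat.toNat_coe, Nat.cast_le]
    exact Nat.le_floor_iff hb

/-- **Mean bound by Chebyshev** (`meas_ge_le_variance_div_sq`). If `P(f ≤ b) ≥ δ` and
`Var f < δ t²` (`t > 0`), then `E f ≤ b + t`: otherwise `{f ≤ b} ⊆ {|f - E f| ≥ t}` would have
probability both `≥ δ` and `< δ`. -/
theorem integral_le_of_variance_lt {Ω : Type*} [MeasurableSpace Ω] {μ : Measure Ω}
    [IsProbabilityMeasure μ] {f : Ω → ℝ} (hf2 : MemLp f 2 μ) {b t δ : ℝ} (ht : 0 < t)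
    (hδ : δ ≤ μ.real {ω | f ω ≤ b}) (hvar : variance f μ < δ * t ^ 2) :
    ∫ ω, f ω ∂μ ≤ b + t := by
  by_contra hlt
  rw [not_le] at hlt
  have hsub : {ω | f ω ≤ b} ⊆ {ω | t ≤ |f ω - ∫ ω', f ω' ∂μ|} := by
    intro ω hω
    rw [Set.mem_setOf_eq] at hω ⊢
    calc t ≤ -(f ω - ∫ ω', f ω' ∂μ) := by linarith
      _ ≤ |f ω - ∫ ω', f ω' ∂μ| := neg_le_abs _
  have hcheb := meas_ge_le_variance_div_sq hf2 ht
  have hreal : μ.real {ω | t ≤ |f ω - ∫ ω', f ω' ∂μ|} ≤ variance f μ / t ^ 2 := by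
    rw [measureReal_def]
    have h := ENNReal.toReal_mono ENNReal.ofReal_ne_top hcheb
    rwa [ENNReal.toReal_ofReal (div_nonneg (variance_nonneg _ _) (sq_nonneg _))] at h
  have hlt' : variance f μ / t ^ 2 < δ := by rwa [div_lt_iff₀ (pow_pos ht 2)]
  have h2 : μ.real {ω | f ω ≤ b} ≤ μ.real {ω | t ≤ |f ω - ∫ ω', f ω' ∂μ|} :=
    measureReal_mono hsub
  linarith

-- adapted from Cruxes/DefectDimension/Lines/anchored-density-contraction.lean (`one_sub_le_real_budgetEvent`)
/-- **Markov** (`mul_meas_ge_le_integral_of_nonneg`): for a nonnegative integrable `f` and `B > 0`,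
`P(f ≤ B) ≥ 1 - E f / B`. -/
theorem one_sub_integral_div_le {Ω : Type*} [MeasurableSpace Ω] {μ : Measure Ω}
    [IsProbabilityMeasure μ] {f : Ω → ℝ} (hfm : Measurable f) (hf0 : 0 ≤ᵐ[μ] f)
    (hfi : Integrable f μ) {B : ℝ} (hB : 0 < B) :
    1 - (∫ ω, f ω ∂μ) / B ≤ μ.real {ω | f ω ≤ B} := by
  have hmarkov := mul_meas_ge_le_integral_of_nonneg hf0 hfi B
  have hmeas : MeasurableSet {ω | f ω ≤ B} := measurableSet_le hfm measurable_const
  have hcompl : {ω | f ω ≤ B}ᶜ ⊆ {ω | B ≤ f ω} := by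
    intro ω hω
    rw [Set.mem_compl_iff, Set.mem_setOf_eq, not_le] at hω
    exact hω.le
  have h1 : μ.real {ω | f ω ≤ B}ᶜ ≤ (∫ ω, f ω ∂μ) / B := by
    rw [le_div_iff₀ hB, mul_comm]
    exact (mul_le_mul_of_nonneg_left (measureReal_mono hcompl) hB.le).trans hmarkov
  rw [measureReal_compl hmeas, probReal_univ] at h1
  linarith

end StubBootstrap

/-- **stub_bootstrap (weak-to-strong principle for the min-cut budget).** If for some `c, δ > 0`
the budget event `MinCut(n,2n) ≤ n^{2-c}` has `P_{p_c}`-probability `≥ δ` at every large scale,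
then for `c' = min(c, 1/4)/2 > 0` the event `MinCut(n,2n) ≤ n^{2-c'}` has probability `→ 1`
(variance `≤ 750 n³` by Efron–Stein; Chebyshev with `t = n^{7/4}` gives
`E MinCut ≤ n^{2-c} + n^{7/4} ≤ 2 n^{2-2c'}`; Markov at the budget `n^{2-c'}`). -/
theorem stub_bootstrap :
    (∃ c δ : ℝ, 0 < c ∧ 0 < δ ∧
        ∀ᶠ n : ℕ in atTop, δ ≤ (bondPercolation (zdGraph 3) (criticalProbI 3)).real
          (budgetEvent n ((n : ℝ) ^ (2 - c)))) →
      ∃ c : ℝ, 0 < c ∧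
        Tendsto (fun n : ℕ => (bondPercolation (zdGraph 3) (criticalProbI 3)).real
          (budgetEvent n ((n : ℝ) ^ (2 - c)))) atTop (𝓝 1) := by
  rintro ⟨c, δ, hc, hδ, hev⟩
  set P : Measure (BondConfig (Site 3)) := bondPercolation (zdGraph 3) (criticalProbI 3) with hP
  -- the new saving is `min(c, 1/4)/2`
  have hm : 0 < min c (1 / 4) := lt_min hc (by norm_num)
  have hm1 : min c (1 / 4) ≤ c := min_le_left _ _
  have hm2 : min c (1 / 4) ≤ 1 / 4 := min_le_right _ _
  refine ⟨min c (1 / 4) / 2, by linarith, ?_⟩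
  -- Chebyshev slack: eventually `750 < δ n^{1/2}`
  have hslack : ∀ᶠ n : ℕ in atTop, (750 : ℝ) < δ * (n : ℝ) ^ (1 / 2 : ℝ) :=
    (((tendsto_rpow_atTop (by norm_num : (0 : ℝ) < 1 / 2)).comp
      tendsto_natCast_atTop_atTop).const_mul_atTop hδ).eventually_gt_atTop 750
  -- squeeze between `1 - 2 n^{-c'} → 1` and `1`
  have hlow : Tendsto (fun n : ℕ => 1 - 2 * (n : ℝ) ^ (-(min c (1 / 4) / 2))) atTop (𝓝 1) := by
    have h1 : Tendsto (fun n : ℕ => (n : ℝ) ^ (-(min c (1 / 4) / 2))) atTop (𝓝 0) :=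
      (tendsto_rpow_neg_atTop (by linarith : 0 < min c (1 / 4) / 2)).comp
        tendsto_natCast_atTop_atTop
    have h2 := h1.const_mul 2
    rw [mul_zero] at h2
    simpa using (tendsto_const_nhds (x := (1 : ℝ))).sub h2
  refine tendsto_of_tendsto_of_tendsto_of_le_of_le' hlow tendsto_const_nhds ?_
    (Eventually.of_forall fun n => measureReal_le_one)
  filter_upwards [hev, hslack, eventually_ge_atTop 1] with n hn hsl hn1
  have hnR : (1 : ℝ) ≤ n := by exact_mod_cast hn1
  have hnpos : (0 : ℝ) < n := by linarith
  obtain ⟨f, hfm, hf0, hf2, hvar, hlevel⟩ := StubBootstrap.exists_observable hn1 (criticalProbI 3)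
  rw [← hP] at hf2 hvar hlevel
  -- (2) the mean bound `E f ≤ n^{2-c} + n^{7/4} ≤ 2 n^{2 - min(c,1/4)}`
  have ht : 0 < (n : ℝ) ^ (7 / 4 : ℝ) := Real.rpow_pos_of_pos hnpos _
  have hsq : ((n : ℝ) ^ (7 / 4 : ℝ)) ^ 2 = (n : ℝ) ^ 3 * (n : ℝ) ^ (1 / 2 : ℝ) := by
    rw [← Real.rpow_two, ← Real.rpow_mul hnpos.le,
      show (7 / 4 : ℝ) * 2 = ((3 : ℕ) : ℝ) + 1 / 2 by norm_num, Real.rpow_add hnpos,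
      Real.rpow_natCast]
  have hvar' : variance f P < δ * ((n : ℝ) ^ (7 / 4 : ℝ)) ^ 2 := by
    calc variance f P ≤ 750 * (n : ℝ) ^ 3 := hvar
      _ < δ * (n : ℝ) ^ (1 / 2 : ℝ) * (n : ℝ) ^ 3 := by gcongr
      _ = δ * ((n : ℝ) ^ (7 / 4 : ℝ)) ^ 2 := by rw [hsq]; ring
  have hδ' : δ ≤ P.real {ω | f ω ≤ (n : ℝ) ^ (2 - c)} := by
    rwa [← measureReal_congr (hlevel _ (Real.rpow_nonneg hnpos.le _))]
  have hμ := StubBootstrap.integral_le_of_variance_lt hf2 ht hδ' hvar'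
  have h1 : (n : ℝ) ^ (2 - c) ≤ (n : ℝ) ^ (2 - min c (1 / 4)) :=
    Real.rpow_le_rpow_of_exponent_le hnR (by linarith)
  have h2 : (n : ℝ) ^ (7 / 4 : ℝ) ≤ (n : ℝ) ^ (2 - min c (1 / 4)) :=
    Real.rpow_le_rpow_of_exponent_le hnR (by linarith)
  have hmean : ∫ ω, f ω ∂P ≤ 2 * (n : ℝ) ^ (2 - min c (1 / 4)) := by linarith
  -- (3) Markov at the budget `n^{2-c'}`
  have hb : (0 : ℝ) < (n : ℝ) ^ (2 - min c (1 / 4) / 2) := Real.rpow_pos_of_pos hnpos _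
  have key := StubBootstrap.one_sub_integral_div_le hfm (ae_of_all _ hf0)
    (hf2.integrable one_le_two) hb
  rw [← measureReal_congr (hlevel _ hb.le)] at key
  have hratio : (∫ ω, f ω ∂P) / (n : ℝ) ^ (2 - min c (1 / 4) / 2) ≤
      2 * (n : ℝ) ^ (-(min c (1 / 4) / 2)) := by
    rw [div_le_iff₀ hb]
    calc ∫ ω, f ω ∂P ≤ 2 * (n : ℝ) ^ (2 - min c (1 / 4)) := hmean
      _ = 2 * ((n : ℝ) ^ (-(min c (1 / 4) / 2)) * (n : ℝ) ^ (2 - min c (1 / 4) / 2)) := by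
          rw [← Real.rpow_add hnpos]
          ring_nf
      _ = 2 * (n : ℝ) ^ (-(min c (1 / 4) / 2)) * (n : ℝ) ^ (2 - min c (1 / 4) / 2) := by ring
  linarith

end Summit.CriticalPhenomena.PercolationContinuityZ3.Theorems

end
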